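import Mathlib
import Summits.Ventures.PercRepro2.Defs
import Summits.Ventures.PercRepro2.Independence
import Summits.Ventures.PercRepro2.Graph
import Summits.Ventures.PercRepro2.Exploration

/-!
# Induced percolation, the events `Q^U_A`, `R^U_X`, and the definitions of p1's toolkit
(blind cell PercRepro2, p1)

* `induced ends U ω` — the configuration with every edge not inside `U` closed: percolation on the
  induced subgraph `G[U]`, on the *same* probability space ("`G − Z`" is `induced (U ∖ Z)`);
  monotone in `ω` and in `U`, determined by the edges inside `U`; vertices reachable from a vertex
  of `U` stay in `U`; `induced Set.univ ω = ω`;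
* `QEvent ends U s A = {s ↔ a in G[U] ∀ a ∈ A}` (increasing) and
  `REvent ends U s X = {s ↮ x in G[U] ∀ x ∈ X}` (decreasing), with their union/intersection,
  antitonicity, vanishing and `DependsOn` lemmas;
* the join/meet of configurations edge by edge (`sup_apply_eq_true_iff`, `inf_apply_eq_true_iff`);
* ALL further definitions used by the p1 files (so that those files contain only theorems):
  the frontier `frontier`, cluster functionals `clusterIn` / `clusterObs`, the deleted-cluster
  configuration `delConfig` with `delClusterProb` / `delExpect`, the cluster-property bridge `Fof`,
  the whole-graph events `connAll` / `avoidAll`, the multi-source events `QEventT` / `REventT` /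
  `connAllT` / `avoidAllT` (the objects of R4+ at `|A| = 2` are in `R4Defs.lean`).
-/

namespace Summit.Ventures.PercRepro2

/-! ## The induced configuration -/

section Induced

open Classical

variable {V : Type*} {E : Type*}

/-- The configuration induced on the vertex set `U`: every edge not inside `U` is closed
(percolation on the induced subgraph `G[U]`, on the same probability space). -/
noncomputable def induced (ends : E → Sym2 V) (U : Set V) (ω : Config E) : Config E :=
  restrict (within ends U) ω

variable {ends : E → Sym2 V}

/-- An edge is open in `induced ends U ω` iff it is open in `ω` and lies inside `U`. -/
lemma induced_eq_true_iff {U : Set V} {ω : Config E} {e : E} :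
    induced ends U ω e = true ↔ ω e = true ∧ e ∈ within ends U := by
  unfold induced
  exact restrict_eq_true_iff

/-- `induced ends U ω ≤ ω`. -/
lemma induced_le (U : Set V) (ω : Config E) : induced ends U ω ≤ ω :=
  restrict_le _ ω

/-- `within` is monotone in the vertex set. -/
lemma within_mono {U U' : Set V} (h : U ⊆ U') : within ends U ⊆ within ends U' :=
  fun _ ⟨x, hx, y, hy, he⟩ => ⟨x, h hx, y, h hy, he⟩

/-- `induced` is monotone in the configuration. -/
lemma induced_mono {U : Set V} {ω ω' : Config E} (h : ω ≤ ω') :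
    induced ends U ω ≤ induced ends U ω' := by
  intro e
  by_cases he : e ∈ within ends U
  · unfold induced
    rw [restrict_apply_of_mem he, restrict_apply_of_mem he]
    exact h e
  · unfold induced
    rw [restrict_apply_of_notMem he]
    exact Bool.false_le _

/-- `induced` is monotone in the vertex set. -/
lemma induced_mono_set {U U' : Set V} (h : U ⊆ U') (ω : Config E) :
    induced ends U ω ≤ induced ends U' ω := by
  intro e
  by_cases he : e ∈ within ends U
  · unfold induced
    rw [restrict_apply_of_mem he, restrict_apply_of_mem (within_mono h he)]
  · unfold induced
    rw [restrict_apply_of_notMem he]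
    exact Bool.false_le _

/-- `induced ends U` only sees the edges inside `U`. -/
lemma induced_congr {U : Set V} {ω ω' : Config E} (h : ∀ e ∈ within ends U, ω e = ω' e) :
    induced ends U ω = induced ends U ω' := by
  unfold induced
  exact restrict_congr h

/-- Both endpoints of an open edge of `induced ends U ω` lie in `U`. -/
lemma mem_and_mem_of_induced_eq_true {U : Set V} {ω : Config E} {e : E} {x y : V}
    (he : induced ends U ω e = true) (hends : ends e = s(x, y)) : x ∈ U ∧ y ∈ U := by
  obtain ⟨_, x', hx', y', hy', hends'⟩ := induced_eq_true_iff.1 he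
  rw [hends, Sym2.eq_iff] at hends'
  rcases hends' with ⟨rfl, rfl⟩ | ⟨rfl, rfl⟩
  · exact ⟨hx', hy'⟩
  · exact ⟨hy', hx'⟩

/-- Vertices reachable in `G[U]` from a vertex of `U` lie in `U`. -/
lemma mem_of_conn_induced {U : Set V} {ω : Config E} {u v : V} (hu : u ∈ U)
    (h : Conn ends (induced ends U ω) u v) : v ∈ U := by
  refine mem_of_conn_of_closed (ends := ends) (ω := induced ends U ω) (S := U) ?_ hu h
  intro x _ y hxy
  obtain ⟨_, e, he, hends⟩ := openGraph_adj.1 hxy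
  exact (mem_and_mem_of_induced_eq_true he hends).2

/-- On the full vertex set nothing is closed: `induced ends Set.univ ω = ω`. -/
lemma induced_univ (ω : Config E) : induced ends Set.univ ω = ω := by
  funext e
  have he : e ∈ within ends Set.univ := by
    obtain ⟨⟨x, y⟩, hxy⟩ := Quot.exists_rep (ends e)
    exact ⟨x, Set.mem_univ x, y, Set.mem_univ y, hxy.symm⟩
  unfold induced
  exact restrict_apply_of_mem he

/-- An edge of the join is open iff it is open in one of the two configurations. -/
lemma sup_apply_eq_true_iff (ω ω' : Config E) (e : E) :
    (ω ⊔ ω') e = true ↔ ω e = true ∨ ω' e = true := by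
  simp only [Pi.sup_apply]
  cases ω e <;> cases ω' e <;> decide

/-- An edge of the meet is open iff it is open in both configurations. -/
lemma inf_apply_eq_true_iff (ω ω' : Config E) (e : E) :
    (ω ⊓ ω') e = true ↔ ω e = true ∧ ω' e = true := by
  simp only [Pi.inf_apply]
  cases ω e <;> cases ω' e <;> decide

end Induced

/-! ## The events `Q^U_A` and `R^U_X` -/

section Events

variable {V : Type*} {E : Type*}

/-- `Q^U_A = {s ↔ a in G[U] for all a ∈ A}`. -/
def QEvent (ends : E → Sym2 V) (U : Finset V) (s : V) (A : Finset V) : Set (Config E) :=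
  {ω | ∀ a ∈ A, Conn ends (induced ends (↑U) ω) s a}

/-- `R^U_X = {s ↮ x in G[U] for all x ∈ X}`. -/
def REvent (ends : E → Sym2 V) (U : Finset V) (s : V) (X : Finset V) : Set (Config E) :=
  {ω | ∀ x ∈ X, ¬ Conn ends (induced ends (↑U) ω) s x}

variable {ends : E → Sym2 V} {U : Finset V} {s : V}

/-- Membership in `QEvent`. -/
@[simp] lemma mem_QEvent {A : Finset V} {ω : Config E} :
    ω ∈ QEvent ends U s A ↔ ∀ a ∈ A, Conn ends (induced ends (↑U) ω) s a := Iff.rfl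

/-- Membership in `REvent`. -/
@[simp] lemma mem_REvent {X : Finset V} {ω : Config E} :
    ω ∈ REvent ends U s X ↔ ∀ x ∈ X, ¬ Conn ends (induced ends (↑U) ω) s x := Iff.rfl

/-- `Q^U_A` is increasing. -/
lemma isUpperSet_QEvent (ends : E → Sym2 V) (U : Finset V) (s : V) (A : Finset V) :
    IsUpperSet (QEvent ends U s A) :=
  fun _ _ h hω a ha => conn_mono (induced_mono h) (hω a ha)

/-- `R^U_X` is decreasing. -/
lemma isLowerSet_REvent (ends : E → Sym2 V) (U : Finset V) (s : V) (X : Finset V) :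
    IsLowerSet (REvent ends U s X) :=
  fun _ _ h hω x hx hc => hω x hx (conn_mono (induced_mono h) hc)

/-- `Q^U_{A ∪ B} = Q^U_A ∩ Q^U_B`. -/
lemma QEvent_union [DecidableEq V] (ends : E → Sym2 V) (U : Finset V) (s : V) (A B : Finset V) :
    QEvent ends U s (A ∪ B) = QEvent ends U s A ∩ QEvent ends U s B := by
  ext ω
  simp only [mem_QEvent, Set.mem_inter_iff, Finset.forall_mem_union]

/-- `R^U_{X ∪ Y} = R^U_X ∩ R^U_Y`. -/
lemma REvent_union [DecidableEq V] (ends : E → Sym2 V) (U : Finset V) (s : V) (X Y : Finset V) :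
    REvent ends U s (X ∪ Y) = REvent ends U s X ∩ REvent ends U s Y := by
  ext ω
  simp only [mem_REvent, Set.mem_inter_iff, Finset.forall_mem_union]

/-- `Q^U_∅` is the sure event. -/
@[simp] lemma QEvent_empty (ends : E → Sym2 V) (U : Finset V) (s : V) :
    QEvent ends U s ∅ = Set.univ := by
  ext ω; simp

/-- `R^U_∅` is the sure event. -/
@[simp] lemma REvent_empty (ends : E → Sym2 V) (U : Finset V) (s : V) :
    REvent ends U s ∅ = Set.univ := by
  ext ω; simp

/-- `R^U_X` is antitone in `X`. -/
lemma REvent_anti (ends : E → Sym2 V) (U : Finset V) (s : V) {X X' : Finset V} (h : X ⊆ X') :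
    REvent ends U s X' ⊆ REvent ends U s X :=
  fun _ hω x hx => hω x (h hx)

/-- `Q^U_A` is antitone in `A`. -/
lemma QEvent_anti (ends : E → Sym2 V) (U : Finset V) (s : V) {A A' : Finset V} (h : A ⊆ A') :
    QEvent ends U s A' ⊆ QEvent ends U s A :=
  fun _ hω a ha => hω a (h ha)

/-- If `s ∈ X` then `R^U_X` is empty. -/
lemma REvent_eq_empty_of_mem (ends : E → Sym2 V) (U : Finset V) {s : V} {X : Finset V}
    (hs : s ∈ X) : REvent ends U s X = ∅ := by
  ext ω
  simp only [mem_REvent, Set.mem_empty_iff_false, iff_false, not_forall, not_not]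
  exact ⟨s, hs, conn_refl _ _ _⟩

/-- If `A` and `X` share a vertex then `Q^U_A ∩ R^U_X` is empty. -/
lemma QEvent_inter_REvent_eq_empty (ends : E → Sym2 V) (U : Finset V) (s : V) {A X : Finset V}
    {a : V} (ha : a ∈ A) (hx : a ∈ X) : QEvent ends U s A ∩ REvent ends U s X = ∅ := by
  ext ω
  simp only [Set.mem_inter_iff, mem_QEvent, mem_REvent, Set.mem_empty_iff_false, iff_false,
    not_and]
  intro hQ hR
  exact hR a hx (hQ a ha)

/-- `Q^U_A` is determined by the edges inside `U`. -/
lemma dependsOn_QEvent (ends : E → Sym2 V) (U : Finset V) (s : V) (A : Finset V) :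
    DependsOn (· ∈ QEvent ends U s A) (within ends (↑U)) := by
  intro ω ω' h
  show (∀ a ∈ A, Conn ends (induced ends (↑U) ω) s a) =
    ∀ a ∈ A, Conn ends (induced ends (↑U) ω') s a
  rw [induced_congr h]

/-- `R^U_X` is determined by the edges inside `U`. -/
lemma dependsOn_REvent (ends : E → Sym2 V) (U : Finset V) (s : V) (X : Finset V) :
    DependsOn (· ∈ REvent ends U s X) (within ends (↑U)) := by
  intro ω ω' h
  show (∀ x ∈ X, ¬ Conn ends (induced ends (↑U) ω) s x) =
    ∀ x ∈ X, ¬ Conn ends (induced ends (↑U) ω') s x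
  rw [induced_congr h]

end Events

/-! ## The frontier of `Z` (definition) -/

section FrontierDef

variable {V : Type*} {E : Type*} [Fintype E] [DecidableEq V]

/-- The frontier of `Z` in `U`: the vertices of `U ∖ Z` joined to `Z` by an open edge of `ω`
(what exploring the edges around `Z` reveals). -/
def frontier (ends : E → Sym2 V) (U Z : Finset V) (ω : Config E) : Finset V :=
  (U \ Z).filter fun y => ∃ e, ω e = true ∧ ∃ z ∈ Z, ends e = s(y, z)

variable {ends : E → Sym2 V} {U Z : Finset V}

/-- Membership in the frontier. -/
lemma mem_frontier {ω : Config E} {y : V} :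
    y ∈ frontier ends U Z ω ↔ (y ∈ U ∧ y ∉ Z) ∧ ∃ e, ω e = true ∧ ∃ z ∈ Z, ends e = s(y, z) := by
  simp only [frontier, Finset.mem_filter, Finset.mem_sdiff]

/-- The frontier lies in `U ∖ Z`. -/
lemma frontier_subset (ω : Config E) : frontier ends U Z ω ⊆ U \ Z :=
  Finset.filter_subset _ _

end FrontierDef

/-! ## Cluster functionals (definitions) -/

section ClusterObsDef

variable {V : Type*} {E : Type*} {R : Type*}

/-- The cluster of `s` in `G[U]`. -/
def clusterIn (ends : E → Sym2 V) (U : Finset V) (s : V) (ω : Config E) : Set V :=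
  cluster ends (induced ends (↑U) ω) s

/-- A cluster functional `F : Set V → R` evaluated on the cluster of `s` in `G[U]`. -/
def clusterObs (ends : E → Sym2 V) (U : Finset V) (s : V) (F : Set V → R) : Config E → R :=
  fun ω => F (clusterIn ends U s ω)

variable {ends : E → Sym2 V} {U : Finset V} {s : V}

/-- Membership in `clusterIn`. -/
@[simp] lemma mem_clusterIn {ω : Config E} {x : V} :
    x ∈ clusterIn ends U s ω ↔ Conn ends (induced ends (↑U) ω) s x := Iff.rfl

/-- Unfolding `clusterObs`. -/
@[simp] lemma clusterObs_apply (F : Set V → R) (ω : Config E) :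
    clusterObs ends U s F ω = F (clusterIn ends U s ω) := rfl

end ClusterObsDef

/-! ## Deleting a vertex set (definitions) -/

section DelConfigDef

variable {V : Type*} {E : Type*}

open Classical in
/-- `delConfig ends W ω`: the configuration `ω` with every edge touching `W` closed
("percolation on `G ∖ W`", on the same probability space; instance-free form of
`restrict (touches ends W)ᶜ`). -/
noncomputable def delConfig (ends : E → Sym2 V) (W : Set V) (ω : Config E) : Config E :=
  fun e => if e ∈ touches ends W then false else ω e

variable {ends : E → Sym2 V}

/-- `delConfig` on an edge touching `W`. -/
lemma delConfig_apply_of_mem {W : Set V} {ω : Config E} {e : E} (h : e ∈ touches ends W) :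
    delConfig ends W ω e = false := by
  simp [delConfig, h]

/-- `delConfig` on an edge not touching `W`. -/
lemma delConfig_apply_of_notMem {W : Set V} {ω : Config E} {e : E} (h : e ∉ touches ends W) :
    delConfig ends W ω e = ω e := by
  simp [delConfig, h]

variable [Fintype E] [DecidableEq E] {R : Type*} [CommRing R]

/-- `g(W) = P(C_t ∈ 𝓥 in G ∖ W)`: the probability that the cluster of `t` after closing every
edge touching `W` belongs to `𝓥`. -/
noncomputable def delClusterProb (p : E → R) (ends : E → Sym2 V) (t : V) (𝓥 : Set (Set V))
    (W : Set V) : R :=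
  prob p {ω | cluster ends (delConfig ends W ω) t ∈ 𝓥}

/-- `g(W) = E[f(t) in G ∖ W]`: the expectation of the cluster property at `t` after closing every
edge touching `W`. -/
noncomputable def delExpect (p : E → R) (ends : E → Sym2 V) (f : V → Config E → R) (t : V)
    (W : Set V) : R :=
  expect p (fun ω => f t (delConfig ends W ω))

end DelConfigDef

/-! ## Cluster properties as set functionals (definition) -/

section FofDef

variable {V : Type*} {E : Type*} {R : Type*} [Zero R]

open Classical in
/-- The value of the cluster property `f` at `s` as a function of the cluster of `s`
(`0` on sets that are not clusters of `s`). -/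
noncomputable def Fof (ends : E → Sym2 V) (f : V → Config E → R) (s : V) (W : Set V) : R :=
  if h : ∃ ω : Config E, cluster ends ω s = W then f s h.choose else 0

end FofDef

/-! ## Whole-graph and multi-source events (definitions) -/

section WholeDefs

variable {V : Type*} {E : Type*}

/-- The event `{s ↔ a for all a ∈ A}` on the whole graph. -/
def connAll (ends : E → Sym2 V) (s : V) (A : Finset V) : Set (Config E) :=
  {ω | ∀ a ∈ A, Conn ends ω s a}

/-- The event `{s ↮ x for all x ∈ X}` on the whole graph. -/
def avoidAll (ends : E → Sym2 V) (s : V) (X : Finset V) : Set (Config E) :=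
  {ω | ∀ x ∈ X, ¬ Conn ends ω s x}

/-- `Q^U_{T,A} = {s ↔ a in G[U] for all s ∈ T, a ∈ A s}`: every source reaches its targets. -/
def QEventT (ends : E → Sym2 V) (U T : Finset V) (A : V → Finset V) : Set (Config E) :=
  {ω | ∀ s ∈ T, ∀ a ∈ A s, Conn ends (induced ends (↑U) ω) s a}

/-- `R^U_{T,X} = {s ↮ x in G[U] for all s ∈ T, x ∈ X}`: no source reaches `X`. -/
def REventT (ends : E → Sym2 V) (U T : Finset V) (X : Finset V) : Set (Config E) :=
  {ω | ∀ s ∈ T, ∀ x ∈ X, ¬ Conn ends (induced ends (↑U) ω) s x}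

/-- The event `{s ↔ a for all s ∈ T, a ∈ A s}` on the whole graph. -/
def connAllT (ends : E → Sym2 V) (T : Finset V) (A : V → Finset V) : Set (Config E) :=
  {ω | ∀ s ∈ T, ∀ a ∈ A s, Conn ends ω s a}

/-- The event `{s ↮ x for all s ∈ T, x ∈ X}` on the whole graph. -/
def avoidAllT (ends : E → Sym2 V) (T : Finset V) (X : Finset V) : Set (Config E) :=
  {ω | ∀ s ∈ T, ∀ x ∈ X, ¬ Conn ends ω s x}

variable {ends : E → Sym2 V} {U T : Finset V}

/-- Membership in `QEventT`. -/
@[simp] lemma mem_QEventT {A : V → Finset V} {ω : Config E} :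
    ω ∈ QEventT ends U T A ↔ ∀ s ∈ T, ∀ a ∈ A s, Conn ends (induced ends (↑U) ω) s a := Iff.rfl

/-- Membership in `REventT`. -/
@[simp] lemma mem_REventT {X : Finset V} {ω : Config E} :
    ω ∈ REventT ends U T X ↔ ∀ s ∈ T, ∀ x ∈ X, ¬ Conn ends (induced ends (↑U) ω) s x := Iff.rfl

end WholeDefs


end Summit.Ventures.PercRepro2
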